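import Mathlib
import Literature.NumberTheory.Transcendental.KZCalculus
import Literature.NumberTheory.Transcendental.KZLogCalculusProofs
import Summits.KontsevichZagierPeriods.KontsevichZagierPeriods.Theorems.TorsionLogsNeronTorsionSectorStubParametersAlgebraic
import Summits.KontsevichZagierPeriods.KontsevichZagierPeriods.Theorems.TorsionLogsNeronTorsionSectorStubGridData
import Summits.KontsevichZagierPeriods.KontsevichZagierPeriods.Theorems.TorsionLogsNeronTorsionSectorAssemblyIface
import Summits.KontsevichZagierPeriods.KontsevichZagierPeriods.Theorems.TorsionLogsNeronTorsionSectorAssemblyXSteps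
import Summits.KontsevichZagierPeriods.KontsevichZagierPeriods.Theorems.TorsionLogsNeronTorsionSectorAssemblyXFold
import Summits.KontsevichZagierPeriods.KontsevichZagierPeriods.Theorems.TorsionLogsNeronTorsionSectorAssemblyCornerSlice
import Summits.KontsevichZagierPeriods.KontsevichZagierPeriods.Theorems.TorsionLogsNeronTorsionSectorAssemblyDecompSlice
import Summits.KontsevichZagierPeriods.KontsevichZagierPeriods.Theorems.TorsionLogsNeronTorsionSectorAssemblyFinal
import Summits.KontsevichZagierPeriods.KontsevichZagierPeriods.Theorems.TorsionLogsNeronTorsionSectorAssemblyLogClass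
import Summits.KontsevichZagierPeriods.KontsevichZagierPeriods.Theorems.TorsionLogsNeronTorsionSectorAssemblyChain
import HarnessLib

/-!
# Crux `TorsionLogs.NeronTorsionSector` (stmt-KontsevichZagierPeriods-14500) — the lead's stub `stub_assembly`

The primitive chain of the line `registered` (translation-only chain on the real torus of `y² = 4x³ − g₂x − g₃`;
see the skeleton `Cruxes/NeronTorsionSector/Lines/birth.lean` and the lead's NOTES): for the curve/torsion data of the
crux, `q²•[rI] + p²•[rP] − c•[1 < t < B, dt/t] ∈ KZ.relations`. Assembled from: parameters and grid
(`stub_parametersAlgebraic`, `stub_gridData`), the interface representations (`asmIface_exists`), the x-chart slices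
(`asmX_steps`, `asmX_fold`), the corner slice (`asmS2_corner`), the decomposition slice (`asmS3_decomp`), the quotient
bookkeeping (`chain_to_logClass` — `stub_bookkeeping` + `stub_periodSymmetry`), and the final packaging
(`exists_carrier_of_logFamily`). [cite: KontsevichZagier2001, §1.2] [cite: Lang1983, Ch. 13 Thm 1.1]
-/

noncomputable section

open Set MeasureTheory Filter Topology
open Literature.NumberTheory.Transcendental Literature.NumberTheory.Transcendental.KZ
open Literature.ModelTheory.ExponentialFields
open Summit.KontsevichZagierPeriods.HyperbolicBloch.OffTetraSectorKernel (isSemialgebraic_logIvl exists_logRep)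

-- `Summit.KontsevichZagierPeriods.KontsevichZagierPeriods.…` is the tree's mandated layout (single-conjunct summit).
set_option linter.dupNamespace false

namespace Summit.KontsevichZagierPeriods.KontsevichZagierPeriods.Cruxes.NeronTorsionSector.Translation

set_option maxHeartbeats 800000 in
-- one long bookkeeping proof; the default budget covers about half of it
/-- **The lead's stub `stub_assembly`: the primitive tied Néron–torsion element is a chain of moves**
(see the module docstring). [cite: KontsevichZagier2001, §1.2] -/
theorem stub_assembly : ∀ (g₂ g₃ e₁ xP yP : ℝ) (N a p q : ℕ) (f : ℝ → ℝ),
    (∀ x, f x = 4 * x ^ 3 - g₂ * x - g₃) → g₂ ^ 3 - 27 * g₃ ^ 2 ≠ 0 → f e₁ = 0 → 0 < e₁ →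
    (∀ x, e₁ < x → 0 < f x) → e₁ < xP → yP ^ 2 = f xP → 3 ≤ N → 0 < a → 2 * a < N →
    (∀ hns : (⟨0, 0, 0, -g₂ / 4, -g₃ / 4⟩ : WeierstrassCurve ℝ).toAffine.Nonsingular xP (yP / 2),
    addOrderOf (WeierstrassCurve.Affine.Point.some xP (yP / 2) hns) = N) →
    (N : ℝ) * (∫ x in Set.Ioi xP, (Real.sqrt (f x))⁻¹) = a * (2 * ∫ x in Set.Ioi e₁, (Real.sqrt (f x))⁻¹) →
    Nat.Coprime p q → (q : ℤ) * ((N : ℤ) - 2 * (a : ℤ)) = (p : ℤ) * (2 * (N : ℤ)) →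
    ∀ (rI rP : Literature.NumberTheory.Transcendental.KZ.IntegralRep 2),
    rI.domain = {z | e₁ < z 1 ∧ z 1 < z 0 ∧ z 0 < xP} →
    Set.EqOn rI.integrand (fun z => z 1 / (Real.sqrt (f (z 1)) * Real.sqrt (f (z 0)))) rI.domain →
    rP.domain = {z | e₁ < z 0 ∧ e₁ < z 1} →
    Set.EqOn rP.integrand
    (fun z => (Real.sqrt (f (z 0)))⁻¹ * ((g₂ * z 1 + 2 * g₃) / (2 * (z 1) ^ 2 * Real.sqrt (f (z 1))))) rP.domain →
    ∃ (c : ℤ) (B : ℝ) (rB : Literature.NumberTheory.Transcendental.KZ.IntegralRep 1), 1 < B ∧ IsAlgebraic ℚ B ∧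
    rB.domain = {t | 1 < t 0 ∧ t 0 < B} ∧ Set.EqOn rB.integrand (fun t => (t 0)⁻¹) rB.domain ∧
    ((q : ℤ) ^ 2) • Literature.NumberTheory.Transcendental.KZ.of rI + ((p : ℤ) ^ 2) • Literature.NumberTheory.Transcendental.KZ.of rP - c • Literature.NumberTheory.Transcendental.KZ.of rB ∈ Literature.NumberTheory.Transcendental.KZ.relations := by
  intro g₂ g₃ e₁ xP yP N a p q f hf hΔ he₁ he₁pos hfpos hxP _hyP hN ha haN _hord hint _hcop hqN rI rP hrId hrIi hrPd hrPi
  classical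
  /- parameters, grid, integers -/
  obtain ⟨ag₂, ag₃, he₁a, hxPa⟩ := stub_parametersAlgebraic g₂ g₃ e₁ xP f hf he₁ he₁pos hfpos hxP rI rP hrId hrIi hrPd hrPi
  obtain ⟨n, m, aa, x, y, hn12, hnm, haa1, haam, hNma, hxm, -, hxaa, hgAlg, hgLow, -, hgDec, hgChord, hInt, hgτ, -⟩ :=
    stub_gridData g₂ g₃ e₁ xP N a f hf hΔ he₁ he₁pos hfpos hxP hN ha haN hint ag₂ ag₃ he₁a hxPa
  have hm6 : 6 ≤ m := by omega
  have hmn : m < n := by omega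
  have h1m : 1 < m := by omega
  have hm1lt : m - 1 < m := by omega
  have h1m1 : 1 ≤ m - 1 := by omega
  have hpqZ : (q : ℤ) * ((m : ℤ) - (aa : ℤ)) = 2 * (p : ℤ) * (m : ℤ) := by
    have e1 : ((2 * N * (m - aa) : ℕ) : ℤ) = 2 * (N : ℤ) * ((m : ℤ) - (aa : ℤ)) := by
      rw [Nat.cast_mul, Nat.cast_mul, Nat.cast_sub haam.le]; push_cast; ring
    have e2 : ((n * (N - 2 * a) : ℕ) : ℤ) = (n : ℤ) * ((N : ℤ) - 2 * (a : ℤ)) := by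
      rw [Nat.cast_mul, Nat.cast_sub (by omega)]; push_cast; ring
    have h0 : ((2 * N * (m - aa) : ℕ) : ℤ) = ((n * (N - 2 * a) : ℕ) : ℤ) := congrArg (fun t : ℕ => (t : ℤ)) hNma
    rw [e1, e2, show (n : ℤ) = 2 * (m : ℤ) by exact_mod_cast hnm] at h0
    have h3 : (N : ℤ) * ((q : ℤ) * ((m : ℤ) - (aa : ℤ)) - 2 * (p : ℤ) * (m : ℤ)) = 0 := by
      have h4 : (q : ℤ) * ((2 * (N : ℤ)) * ((m : ℤ) - (aa : ℤ))) = (2 * (m : ℤ)) * ((q : ℤ) * ((N : ℤ) - 2 * (a : ℤ))) := by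
        rw [h0]; ring
      rw [hqN] at h4; linarith
    rcases mul_eq_zero.mp h3 with h | h
    · exact absurd h (by exact_mod_cast (show N ≠ 0 by omega))
    · linarith
  have hgAlg' : ∀ k, 1 ≤ k → k ≤ m → IsAlgebraic ℚ (x k) := by
    intro k hk hkm
    rcases hkm.eq_or_lt with rfl | hlt
    · rw [hxm]; exact he₁a
    · exact (hgAlg k hk (by omega)).1
  have hgAlgy : ∀ k, 1 ≤ k → k < m → IsAlgebraic ℚ (y k) ∧ y k ^ 2 = f (x k) := fun k hk hkm =>
    ⟨(hgAlg k hk (by omega)).2.1, (hgAlg k hk (by omega)).2.2.1⟩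
  have hx1 : e₁ < x 1 ∧ y 1 < 0 := hgLow 1 le_rfl h1m
  have hy1 := hgAlgy 1 le_rfl h1m
  have hx1alg : IsAlgebraic ℚ (x 1) := hgAlg' 1 le_rfl h1m.le
  /- the formula functions -/
  set L₁ : ℝ := (12 * x 1 ^ 2 - g₂) / (2 * y 1) with hL₁
  have hx2 : x 2 = L₁ ^ 2 / 4 - 2 * x 1 ∧ y 2 = -(y 1 + L₁ * (x 2 - x 1)) := by
    obtain ⟨_, h2, h3⟩ := hgChord 1 le_rfl (by omega)
    have hsl1 : (4 * x 1 ^ 2 + 4 * x 1 * x 1 + 4 * x 1 ^ 2 - g₂) / (y 1 + y 1) = L₁ := by rw [hL₁]; congr 1 <;> ring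
    simp only [hsl1] at h2 h3
    exact ⟨by rw [h2]; ring, by rw [h3]⟩
  obtain ⟨yb, hyb⟩ : ∃ g : ℝ → ℝ, g = fun t => -Real.sqrt (f t) := ⟨_, rfl⟩
  obtain ⟨sl, hsl⟩ : ∃ g : ℝ → ℝ, g = fun t => (4 * t ^ 2 + 4 * t * x 1 + 4 * x 1 ^ 2 - g₂) / (yb t + y 1) := ⟨_, rfl⟩
  obtain ⟨τ, hτ⟩ : ∃ g : ℝ → ℝ, g = fun t => sl t ^ 2 / 4 - t - x 1 := ⟨_, rfl⟩
  obtain ⟨Y3, hY3⟩ : ∃ g : ℝ → ℝ, g = fun t => -(yb t + sl t * (τ t - t)) := ⟨_, rfl⟩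
  obtain ⟨Qf, hQf⟩ : ∃ g : ℝ → ℝ, g = fun t => sl t / 2 + Y3 t / (2 * τ t) - yb t / (2 * t) := ⟨_, rfl⟩
  obtain ⟨sl3, hsl3⟩ : ∃ g : ℝ → ℝ, g = fun t => (4 * τ t ^ 2 + 4 * τ t * x 1 + 4 * x 1 ^ 2 - g₂) / (Y3 t + y 1) := ⟨_, rfl⟩
  obtain ⟨X33, hX33⟩ : ∃ g : ℝ → ℝ, g = fun t => sl3 t ^ 2 / 4 - τ t - x 1 := ⟨_, rfl⟩
  obtain ⟨Y33, hY33⟩ : ∃ g : ℝ → ℝ, g = fun t => -(Y3 t + sl3 t * (X33 t - τ t)) := ⟨_, rfl⟩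
  obtain ⟨Qf3, hQf3⟩ : ∃ g : ℝ → ℝ, g = fun t => sl3 t / 2 + Y33 t / (2 * X33 t) - Y3 t / (2 * τ t) := ⟨_, rfl⟩
  obtain ⟨Pg, hPg⟩ : ∃ g : ℝ → ℝ, g = fun t => 4 * (t + 2 * x 1) * y 1 - L₁ * (4 * t ^ 2 + 4 * t * x 1 + 4 * x 1 ^ 2 - g₂)
      + 4 * (t + 2 * x 1) * yb t := ⟨_, rfl⟩
  obtain ⟨G, hG⟩ : ∃ g : ℝ → ℝ, g = fun t => Pg t / (yb t + y 1) ^ 2 * Real.sqrt (t * X33 t) / τ t := ⟨_, rfl⟩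
  obtain ⟨τ', hτ'⟩ : ∃ g : ℝ → ℝ, g = fun t => Y3 t / yb t := ⟨_, rfl⟩
  obtain ⟨_, _, hτmono0, hτimg0, hτcell, hτfanti, hτfimg, hτe₁, hτm1⟩ := hgτ τ (by
    rw [hτ]; funext t; simp only [hsl, hyb])
  /- the interface representations and the slices -/
  obtain ⟨Tx, C1, C10, Θx, L1, hTx, hC1, ⟨hC10d, hC10i⟩, hΘx, hL1⟩ := asmIface_exists g₂ g₃ e₁ L₁ m x y f yb sl τ Y3 Qf sl3
    X33 Y33 Qf3 Pg G τ' hf he₁ he₁pos hfpos hm6 hxm hgLow hgDec hgAlg' hgAlgy ag₂ ag₃ hL₁ hx2.1 hx2.2 hyb hsl hτ hY3 hQf hsl3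
    hX33 hY33 hQf3 hPg hG hτ' hInt hτmono0 hτimg0 hτcell hτfanti hτfimg hτe₁ hτm1
  obtain ⟨XSup, XScell, XSadd, hQfalg⟩ := asmX_steps g₂ g₃ e₁ L₁ m x y f yb sl τ Y3 Qf sl3 X33 Y33 Qf3 Pg G τ' hf he₁ he₁pos
    hfpos hm6 hxm hgLow hgDec hgAlg' hgAlgy ag₂ ag₃ hL₁ hx2.1 hx2.2 hyb hsl hτ hY3 hQf hsl3 hX33 hY33 hQf3 hPg hG hτ' hInt
    hτmono0 hτimg0 hτcell hτfanti hτfimg hτe₁ hτm1 Tx C1 Θx L1 hTx hC1 hΘx hL1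
  obtain ⟨hQfe₁, XFfold, XFlog⟩ := asmX_fold g₂ g₃ e₁ L₁ m x y f yb sl τ Y3 Qf sl3 X33 Y33 Qf3 Pg G τ' hf he₁ he₁pos hfpos
    hm6 hxm hgLow hgDec hgAlg' hgAlgy ag₂ ag₃ hL₁ hx2.1 hx2.2 hyb hsl hτ hY3 hQf hsl3 hX33 hY33 hQf3 hPg hG hτ' hInt hτmono0
    hτimg0 hτcell hτfanti hτfimg hτe₁ hτm1 Tx C1 Θx L1 hTx hC1 hΘx hL1
  obtain ⟨T0, Th0, Thl, S2a, S2b, S2c, S2d, S2e⟩ := asmS2_corner g₂ g₃ e₁ L₁ m x y f yb sl τ Y3 Qf sl3 X33 Y33 Qf3 Pg G τ'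
    hf he₁ he₁pos hfpos hm6 hxm hgLow hgDec hgAlg' hgAlgy ag₂ ag₃ hL₁ hx2.1 hx2.2 hyb hsl hτ hY3 hQf hsl3 hX33 hY33 hQf3 hPg
    hG hτ' hInt hτmono0 hτimg0 hτcell hτfanti hτfimg hτe₁ hτm1 (Tx 1) (C1 1) C10 (Θx 1) L1 (hTx 1 le_rfl h1m).1
    (hTx 1 le_rfl h1m).2 (hC1 1 le_rfl h1m).1 (hC1 1 le_rfl h1m).2 hC10d hC10i (hΘx 1 le_rfl h1m).1 (hΘx 1 le_rfl h1m).2 hL1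
  obtain ⟨rB₀, hrB₀d, hrB₀i, S3I, S3P⟩ := asmS3_decomp g₂ g₃ e₁ L₁ m x y f yb sl τ Y3 Qf sl3 X33 Y33 Qf3 Pg G τ' hf he₁
    he₁pos hfpos hm6 hxm hgLow hgDec hgAlg' hgAlgy ag₂ ag₃ hL₁ hx2.1 hx2.2 hyb hsl hτ hY3 hQf hsl3 hX33 hY33 hQf3 hPg hG hτ'
    hInt hτmono0 hτimg0 hτcell hτfanti hτfimg hτe₁ hτm1 aa xP rI rP Tx C1 C10 haa1 haam hxaa hxPa hrId hrIi hrPd hrPi hTx hC1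
    hC10d hC10i
  /- the q-values -/
  set q₀ : ℝ := y 1 / (2 * x 1) with hq₀
  have hq₀alg : IsAlgebraic ℚ q₀ := by
    rw [hq₀, div_eq_mul_inv]
    exact hy1.1.mul (IsAlgebraic.inv_iff.mpr ((by simpa using isAlgebraic_algebraMap (R := ℚ) (A := ℝ) (2 : ℚ) :
      IsAlgebraic ℚ (2:ℝ)).mul hx1alg))
  let qfun : ℕ → ℝ := fun r => if r = 0 ∨ r = n - 1 then q₀ else if r < m then Qf (x r) else Qf (x (n - 1 - r))
  let qv : ℕ → ℝ := fun k => qfun (k % n)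
  have hn0 : 0 < n := by omega
  have hper : ∀ k, qv (k + n) = qv k := fun k => by simp [qv, Nat.add_mod_right]
  have hqv_lt : ∀ k, k < n → qv k = qfun k := fun k hk => by simp [qv, Nat.mod_eq_of_lt hk]
  have hsym : ∀ i, i < n → qv i = qv (n - 1 - i) := by
    intro i hi
    rw [hqv_lt i hi, hqv_lt (n - 1 - i) (by omega)]
    simp only [qfun]
    by_cases h0 : i = 0 ∨ i = n - 1
    · have h0' : n - 1 - i = 0 ∨ n - 1 - i = n - 1 := by omega
      rw [if_pos h0, if_pos h0']
    · have h0' : ¬ (n - 1 - i = 0 ∨ n - 1 - i = n - 1) := by omega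
      rw [if_neg h0, if_neg h0']
      by_cases him : i < m
      · rw [if_pos him, if_neg (show ¬ n - 1 - i < m by omega), show n - 1 - (n - 1 - i) = i by omega]
      · rw [if_neg him, if_pos (show n - 1 - i < m by omega)]
  have hqv_mid : ∀ k, 1 ≤ k → k < m → qv k = Qf (x k) := by
    intro k hk hkm
    rw [hqv_lt k (by omega)]; simp only [qfun]; rw [if_neg (by omega), if_pos hkm]
  have hqv_zero : qv 0 = q₀ := by rw [hqv_lt 0 hn0]; simp [qfun]
  have hqv_m : qv m = Qf e₁ := by
    rw [hqv_lt m hmn]; simp only [qfun]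
    rw [if_neg (by omega), if_neg (lt_irrefl m), show n - 1 - m = m - 1 by omega, hQfe₁]
  have hqalg : ∀ k, IsAlgebraic ℚ (qv k) := by
    intro k
    have hk : k % n < n := Nat.mod_lt _ hn0
    show IsAlgebraic ℚ (qfun (k % n))
    simp only [qfun]
    split_ifs with h0 h1
    · exact hq₀alg
    · exact hQfalg _ (by omega) h1
    · exact hQfalg _ (by omega) (by omega)
  /- the chain data -/
  let Lf : ℝ → FormalRep := fun v => if IsAlgebraic ℚ v then of (L1 v) else 0
  let Tf : ℕ → FormalRep := fun j => if j = 0 then of T0 else of (Tx j)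
  let Cf : ℕ → FormalRep := fun j => if j = 0 then of C10 else of (C1 j)
  let Θf : ℕ → FormalRep := fun j => if j = 0 then of Th0 else of (Θx j)
  have hLf : ∀ v, IsAlgebraic ℚ v → Lf v = of (L1 v) := fun v hv => by simp [Lf, hv]
  have hTf : ∀ j, 1 ≤ j → Tf j = of (Tx j) := fun j hj => by simp [Tf, Nat.one_le_iff_ne_zero.mp hj]
  have hCf : ∀ j, 1 ≤ j → Cf j = of (C1 j) := fun j hj => by simp [Cf, Nat.one_le_iff_ne_zero.mp hj]
  have hΘf : ∀ j, 1 ≤ j → Θf j = of (Θx j) := fun j hj => by simp [Θf, Nat.one_le_iff_ne_zero.mp hj]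
  have hTf0 : Tf 0 = of T0 := by simp [Tf]
  have hCf0 : Cf 0 = of C10 := by simp [Cf]
  have hΘf0 : Θf 0 = of Th0 := by simp [Θf]
  have hq1alg : IsAlgebraic ℚ (Qf (x 1)) := hQfalg 1 le_rfl h1m
  have hLadd : ∀ a b : ℝ, IsAlgebraic ℚ a → IsAlgebraic ℚ b → Lf (a + b) - Lf a - Lf b ∈ relations := by
    intro a b ha hb; rw [hLf _ (ha.add hb), hLf a ha, hLf b hb]; exact XSadd a b ha hb
  have hT : ∀ j, j + 1 < m → Tf (j + 1) - Tf j - Lf (qv (j + 1)) + Θf j ∈ relations := by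
    intro j hj1m
    have h1j1 : 1 ≤ j + 1 := Nat.le_add_left 1 j
    rw [hTf (j + 1) h1j1, hLf _ (hqalg _), hqv_mid (j + 1) h1j1 hj1m]
    rcases Nat.eq_zero_or_pos j with rfl | hj
    · rw [hTf0, hΘf0]; exact S2a
    · rw [hTf j hj, hΘf j hj]; exact XSup j hj hj1m
  have hF : Cf (m - 1) - 2 • Tf (m - 1) - Lf (qv m) + Θf (m - 1) ∈ relations := by
    rw [hCf (m - 1) h1m1, hTf (m - 1) h1m1, hΘf (m - 1) h1m1, hLf _ (hqalg m), hqv_m]; exact XFfold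
  have hCr : ∀ j, j + 1 < m → Cf (j + 1) - Cf j - Lf (qv (j + 1)) + Lf (qv j) ∈ relations := by
    intro j hj1m
    have h1j1 : 1 ≤ j + 1 := Nat.le_add_left 1 j
    rw [hCf (j + 1) h1j1, hLf _ (hqalg _), hLf _ (hqalg _), hqv_mid (j + 1) h1j1 hj1m]
    rcases Nat.eq_zero_or_pos j with rfl | hj
    · rw [hCf0, hqv_zero]; exact S2b
    · rw [hCf j hj, hqv_mid j hj (Nat.lt_of_succ_lt hj1m)]; exact XScell j hj hj1m
  have hW : 2 • Tf 0 - Cf 0 - Lf (qv 0) + of Thl ∈ relations := by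
    rw [hTf0, hCf0, hLf _ (hqalg 0), hqv_zero]; exact S2c
  have hΘ : ∀ j, 1 ≤ j → j < m → ∃ (v : ℝ) (κ : ℕ) (α β : Fin κ → ℝ) (ε : Fin κ → ℤ) (cs : Fin κ → IntegralRep 1),
      (∀ i, 0 < α i ∧ α i ≤ β i ∧ IsAlgebraic ℚ (α i) ∧ IsAlgebraic ℚ (β i) ∧
        (cs i).domain = {t | α i < t 0 ∧ t 0 < β i} ∧
        Set.EqOn (cs i).integrand (fun t => 1 / t 0) (cs i).domain) ∧
      ∑ i, (ε i : ℝ) * Real.log (β i / α i) = v ∧ (Θf j - Θf 0) - ∑ i, ε i • of (cs i) ∈ relations := by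
    intro j hj hjm
    rw [hΘf j hj, hΘf0]
    obtain ⟨v, hv⟩ := XFlog j hj hjm
    obtain ⟨v', hv'⟩ := S2d
    have h := logClass_add hv hv'
    rw [sub_add_sub_cancel] at h
    exact ⟨_, h⟩
  have hB : ∃ (v : ℝ) (κ : ℕ) (α β : Fin κ → ℝ) (ε : Fin κ → ℤ) (cs : Fin κ → IntegralRep 1),
      (∀ i, 0 < α i ∧ α i ≤ β i ∧ IsAlgebraic ℚ (α i) ∧ IsAlgebraic ℚ (β i) ∧
        (cs i).domain = {t | α i < t 0 ∧ t 0 < β i} ∧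
        Set.EqOn (cs i).integrand (fun t => 1 / t 0) (cs i).domain) ∧
      ∑ i, (ε i : ℝ) * Real.log (β i / α i) = v ∧ (Θf 0 - of Thl) - ∑ i, ε i • of (cs i) ∈ relations := by
    rw [hΘf0]; exact S2e
  obtain ⟨vX, κX, αX, βX, εX, csX, hcsX, hsumX, hrelX⟩ := chain_to_logClass n m aa (p : ℤ) (q : ℤ) hnm haam hpqZ qv hper
    hsym hqalg Tf Cf Θf (of Thl) Lf hLadd hT hF hCr hW hΘ hB
  /- the conclusion -/
  have hS : ∑ j ∈ Finset.Ico aa m, Tf j + ∑ j ∈ Finset.Ico aa m, ((j : ℤ) - (aa : ℤ)) • Cf j =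
      ∑ j ∈ Finset.Ico aa m, of (Tx j) + ∑ j ∈ Finset.Ico aa m, ((j : ℤ) - (aa : ℤ)) • of (C1 j) := by
    congr 1
    · exact Finset.sum_congr rfl fun j hj => hTf j (haa1.trans (Finset.mem_Ico.mp hj).1)
    · exact Finset.sum_congr rfl fun j hj => by rw [hCf j (haa1.trans (Finset.mem_Ico.mp hj).1)]
  have hP : of rP - (2 * (m : ℤ)) • ∑ j ∈ Finset.range m, Cf j ∈ relations := S3P
  have hkey : ((q : ℤ) ^ 2 • of rB₀ +
      (-((q : ℤ) ^ 2) • (∑ j ∈ Finset.Ico aa m, Tf j + ∑ j ∈ Finset.Ico aa m, ((j : ℤ) - (aa : ℤ)) • Cf j)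
        + (2 * (p : ℤ) ^ 2 * (m : ℤ)) • ∑ j ∈ Finset.range m, Cf j))
      - (((q : ℤ) ^ 2) • of rI + ((p : ℤ) ^ 2) • of rP) ∈ relations := by
    rw [hS, show ((q : ℤ) ^ 2 • of rB₀ +
      (-((q : ℤ) ^ 2) • (∑ j ∈ Finset.Ico aa m, of (Tx j) + ∑ j ∈ Finset.Ico aa m, ((j : ℤ) - (aa : ℤ)) • of (C1 j))
        + (2 * (p : ℤ) ^ 2 * (m : ℤ)) • ∑ j ∈ Finset.range m, Cf j))
      - (((q : ℤ) ^ 2) • of rI + ((p : ℤ) ^ 2) • of rP) =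
      -(((q : ℤ) ^ 2) • (of rI - of rB₀ + (∑ j ∈ Finset.Ico aa m, of (Tx j) +
          ∑ j ∈ Finset.Ico aa m, ((j : ℤ) - (aa : ℤ)) • of (C1 j))))
      - ((p : ℤ) ^ 2) • (of rP - (2 * (m : ℤ)) • ∑ j ∈ Finset.range m, Cf j) by module]
    exact relations.sub_mem (relations.neg_mem (relations.zsmul_mem S3I _)) (relations.zsmul_mem hP _)
  have hxPe : 1 < xP / e₁ := (one_lt_div he₁pos).2 hxP
  have hB₀1 : 1 ≤ Real.sqrt (xP / e₁) := by rw [← Real.sqrt_one]; exact Real.sqrt_le_sqrt hxPe.le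
  have hB₀alg : IsAlgebraic ℚ (Real.sqrt (xP / e₁)) := by
    have h2 : IsAlgebraic ℚ (Real.sqrt (xP / e₁) ^ 2) := by
      rw [Real.sq_sqrt (by positivity), div_eq_mul_inv]; exact hxPa.mul (IsAlgebraic.inv_iff.mpr he₁a)
    exact isAlgebraic_iff_isIntegral.mpr (IsIntegral.of_pow (n := 2) two_pos (isAlgebraic_iff_isIntegral.mp h2))
  have hLCB := logClass_zsmul ((q : ℤ) ^ 2) (logClass_carrier one_pos hB₀1 isAlgebraic_one hB₀alg rB₀ hrB₀d hrB₀i)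
  obtain ⟨κ, α, β, ε, cs, hcs, -, hrel⟩ := logClass_congr hkey (logClass_add hLCB ⟨κX, αX, βX, εX, csX, hcsX, hsumX, hrelX⟩)
  obtain ⟨c, B, rB, hB1, hBalg, hrBd, hrBi, hfin⟩ := exists_carrier_of_logFamily
    (((q : ℤ) ^ 2) • of rI + ((p : ℤ) ^ 2) • of rP) α β ε cs (fun i => (hcs i).1) (fun i => (hcs i).2.1)
    (fun i => (hcs i).2.2.1) (fun i => (hcs i).2.2.2.1) (fun i => (hcs i).2.2.2.2.1) (fun i => (hcs i).2.2.2.2.2) hrel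
  exact ⟨c, B, rB, hB1, hBalg, hrBd, hrBi, hfin⟩

end Summit.KontsevichZagierPeriods.KontsevichZagierPeriods.Cruxes.NeronTorsionSector.Translation

namespace Summit.KontsevichZagierPeriods.KontsevichZagierPeriods.Cruxes.NeronTorsionSector.Translation

/-- **F3, kernel-visible form of the floor** (on-path lander fwd2-land-1-g30, for the line
`Cruxes/TorsionSectorComplete/Lines/NeronTorsionModularArc.lean` of crux stmt-KontsevichZagierPeriods-14212):
the statement of the floor theorem `stub_assembly`, VERBATIM, is equivalent to `True`.  A `simp` pre-lemma, so
that the tribunal's cheap `specialises` portfolio (`intro h; simpa [Rung] using h`, no library search) closes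
`Rung → <type of stub_assembly>` for every rung whose floor is `stub_assembly`: the goal is rewritten to `True`
at the root before `simp` descends into the telescope. No new mathematics (`iff_true_intro stub_assembly`). -/
@[simp↓] theorem stub_assembly_iff_true : (∀ (g₂ g₃ e₁ xP yP : ℝ) (N a p q : ℕ) (f : ℝ → ℝ),
    (∀ x, f x = 4 * x ^ 3 - g₂ * x - g₃) → g₂ ^ 3 - 27 * g₃ ^ 2 ≠ 0 → f e₁ = 0 → 0 < e₁ →
    (∀ x, e₁ < x → 0 < f x) → e₁ < xP → yP ^ 2 = f xP → 3 ≤ N → 0 < a → 2 * a < N →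
    (∀ hns : (⟨0, 0, 0, -g₂ / 4, -g₃ / 4⟩ : WeierstrassCurve ℝ).toAffine.Nonsingular xP (yP / 2),
    addOrderOf (WeierstrassCurve.Affine.Point.some xP (yP / 2) hns) = N) →
    (N : ℝ) * (∫ x in Set.Ioi xP, (Real.sqrt (f x))⁻¹) = a * (2 * ∫ x in Set.Ioi e₁, (Real.sqrt (f x))⁻¹) →
    Nat.Coprime p q → (q : ℤ) * ((N : ℤ) - 2 * (a : ℤ)) = (p : ℤ) * (2 * (N : ℤ)) →
    ∀ (rI rP : Literature.NumberTheory.Transcendental.KZ.IntegralRep 2),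
    rI.domain = {z | e₁ < z 1 ∧ z 1 < z 0 ∧ z 0 < xP} →
    Set.EqOn rI.integrand (fun z => z 1 / (Real.sqrt (f (z 1)) * Real.sqrt (f (z 0)))) rI.domain →
    rP.domain = {z | e₁ < z 0 ∧ e₁ < z 1} →
    Set.EqOn rP.integrand
    (fun z => (Real.sqrt (f (z 0)))⁻¹ * ((g₂ * z 1 + 2 * g₃) / (2 * (z 1) ^ 2 * Real.sqrt (f (z 1))))) rP.domain →
    ∃ (c : ℤ) (B : ℝ) (rB : Literature.NumberTheory.Transcendental.KZ.IntegralRep 1), 1 < B ∧ IsAlgebraic ℚ B ∧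
    rB.domain = {t | 1 < t 0 ∧ t 0 < B} ∧ Set.EqOn rB.integrand (fun t => (t 0)⁻¹) rB.domain ∧
    ((q : ℤ) ^ 2) • Literature.NumberTheory.Transcendental.KZ.of rI + ((p : ℤ) ^ 2) • Literature.NumberTheory.Transcendental.KZ.of rP - c • Literature.NumberTheory.Transcendental.KZ.of rB ∈ Literature.NumberTheory.Transcendental.KZ.relations) ↔ True :=
  iff_true_intro stub_assembly

end Summit.KontsevichZagierPeriods.KontsevichZagierPeriods.Cruxes.NeronTorsionSector.Translation
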